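import Literature.Analysis.FluidPDE.TorusNSVDataExistenceLimits
import Literature.Analysis.FluidPDE.TorusClassicalNSContinuation
import Literature.Analysis.FunctionSpaces.TorusClassicalNSVStability
import Literature.Analysis.FunctionSpaces.TorusGevreySobolevBounds
import HarnessLib

/-!
# Limits of classical Navier–Stokes solutions on `T³` solve the equations: restart windows from
# the Gevrey-class limit slices and locality in time

Analysis/FluidPDE proof file (theorems only; no definitions, no named facts): the IDENTIFICATION
STEP of the construction of strong solutions from `V`-data by smooth approximation
(Robinson–Rodrigo–Sadowski 2016, Thm 6.8 with Thm 7.5 and §8.1). Let `(U_N, P_N)` be classical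
solutions of NS_ν(F) on `[0, T₀] × T^d`, `card d = 3`, `ν > 0`, near a background solution `(ū, p̄)`
of the same forced system on `[0, L]`, `T₀ ≤ L/2`, with mean-zero slices and `‖∇U_N(t)‖₂² ≤ E₁'`, and
let `u` be a family of smooth divergence-free mean-zero slices on `(0, T₀]` with `‖∇u(t)‖₂² ≤ E₁'`,
`U_N(t) → u(t)` in `H¹` for every `t ∈ (0, T₀]`, uniformly of Gevrey class on every `[τ, T₀]`
(the output of `Torus.exists_limit_slices_of_h1Cauchy`). Then
(`Torus.IsClassicalNSSolutionOn.exists_pressure_of_limit_slices`) there is a pressure `p` with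
`(u, p)` a classical solution of NS_ν(F) on `(0, T₀) × T^d`.

THE ARGUMENT. (1) Windows (`exists_window_of_limit_slices`): for `t ∈ (0, T₀)` put `τ = t/2`; the
Gevrey bound on `[τ, T₀]` gives fourth Sobolev sums of `u(s) − ū(s)` bounded by `M(τ)`
(`Torus.exists_sobolevBounds_of_gevreyBound`, the `H⁴` bound of `ū` on `[0, L]`,
`Torus.sum_mul_norm_sq_mFourierCoeff_sub_le`), so the capped perturbed local existence theorem
(`Torus.perturbedNS_exists_local_of_le`) restarts the forced system from `u(s)` at every
`s ∈ [τ, T₀)` with a step `θ(τ)` (`Torus.IsClassicalNSSolutionOn.add_perturbation`); on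
`[s, s + τ₃]`, `τ₃ = min (min θ T₂') (T₀ − s)`, the restarted solution `ũ` and the `U_N` have
enstrophy `≤ 2E₁' + 1` and `∫ ‖ΔU_N‖² ≤ Y'` (`enstrophy_lifespan` at level `E₁'`), so `V`-stability
(`h1_sub_le_mul_of_integral_laplacian_sq_le`) gives `U_N(r) → ũ(r)` in `L²`, whence `ũ(r) = u(r)`
(`Torus.eq_of_tendsto_integral_norm_sub_sq`); with `s = max τ (t − τ₃'/2)` the window contains `t` in
its interior. (2) Locality (`exists_pressure_of_limit_slices`): the pressures of the windows,
normalised at a base point, agree wherever two windows overlap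
(`pressure_sub_eq_of_eventuallyEq`), and `Torus.IsClassicalNSSolutionOn.of_local` on the open
interval `(0, T₀)` concludes.

## Tree search

Reused: `Torus.perturbedNS_exists_local_of_le`, `Torus.IsClassicalNSSolutionOn.add_perturbation`
(`TorusClassicalNSPerturbedRestart`), `….of_local`, `….sub_pressure_apply` (`TorusClassicalNSRestart`),
`….pressure_sub_eq_of_eventuallyEq` (`TorusClassicalNSGluing`), `….enstrophy_lifespan`,
`….h1_sub_le_mul_of_integral_laplacian_sq_le`, `Torus.exists_sobolevBounds_of_gevreyBound`,
`Torus.sum_one_add_freqNormSq_pow_four_mul_sq_norm_mFourierCoeff_le`,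
`Torus.IsSmoothSpaceTimeOn.exists_integral_norm_laplacian_laplacian_sq_le`, `Torus.divergence_sub`.

## References

* J. C. Robinson, J. L. Rodrigo, W. Sadowski, *The Three-Dimensional Navier–Stokes Equations*,
  CUP 2016, Thm 6.8, Thm 7.5, §8.1. [RobinsonRodrigoSadowskiCUP2016]
* A. J. Majda, A. L. Bertozzi, *Vorticity and Incompressible Flow*, CUP 2002, §3.2.3.
  [MajdaBertozziCUP2002]
-/

noncomputable section

open MeasureTheory Set Function Filter UnitAddTorus
open scoped ContDiff InnerProductSpace Topology ENNReal

namespace Literature.Analysis.FluidPDE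

open Literature.Analysis.FunctionSpaces

variable {d : Type*} [Fintype d] [DecidableEq d]

section Windows

variable {ν L T₀ E₁' : ℝ} {F : UnitAddTorus d → EuclideanSpace ℝ d}
  {ū : ℝ → UnitAddTorus d → EuclideanSpace ℝ d} {pbar : ℝ → UnitAddTorus d → ℝ}
  {U : ℕ → ℝ → UnitAddTorus d → EuclideanSpace ℝ d} {P : ℕ → ℝ → UnitAddTorus d → ℝ}
  {u : ℝ → UnitAddTorus d → EuclideanSpace ℝ d}

/-- **Restart windows from the limit slices.** In the setting of the file header, every
`t ∈ (0, T₀)` lies in the interior of a window `[s, e] ⊆ (0, T₀]` carrying a classical solution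
`(ũ, p̃)` of NS_ν(F) with `ũ = u` on `[s, e]` (restart of the forced system from the Gevrey-class
slice `u(s)` by the capped perturbed local existence theorem around `ū`, identified with the limit of
the `U_N` by `V`-stability; Robinson–Rodrigo–Sadowski 2016, §8.1). [folklore] -/
theorem _root_.Literature.Analysis.FunctionSpaces.Torus.IsClassicalNSSolutionOn.exists_window_of_limit_slices
    (hd : Fintype.card d = 3) (hν : 0 < ν)
    (hū : Torus.IsClassicalNSSolutionOn (Icc 0 L) ν (fun _ => F) ū pbar)
    (hūmean : ∀ t ∈ Icc 0 L, Torus.HasZeroMean (ū t)) (hT₀ : 0 < T₀) (hT₀L : T₀ + L / 2 ≤ L)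
    (hU : ∀ N, Torus.IsClassicalNSSolutionOn (Icc 0 T₀) ν (fun _ => F) (U N) (P N))
    (hUmean : ∀ N, ∀ t ∈ Icc 0 T₀, Torus.HasZeroMean (U N t))
    (hUE : ∀ N, ∀ t ∈ Icc 0 T₀, Torus.gradNormSq (U N t) ≤ E₁')
    (hus : ∀ t ∈ Ioc 0 T₀, Torus.IsSmooth (u t)) (hudiv : ∀ t ∈ Ioc 0 T₀, Torus.IsDivFree (u t))
    (humean : ∀ t ∈ Ioc 0 T₀, Torus.HasZeroMean (u t))
    (huE : ∀ t ∈ Ioc 0 T₀, Torus.gradNormSq (u t) ≤ E₁')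
    (hconv : ∀ t ∈ Ioc 0 T₀, Tendsto (fun N => (∫ x, ‖U N t x - u t x‖ ^ 2) +
      Torus.gradNormSq (fun x => U N t x - u t x)) atTop (𝓝 0))
    (hGev : ∀ τ : ℝ, 0 < τ → ∃ σ : ℝ, 0 < σ ∧ ∃ Cg : ℝ, ∀ t ∈ Icc τ T₀, ∀ S : Finset (d → ℤ),
      ∑ k ∈ S, Real.exp (2 * σ * Real.sqrt (Torus.freqNormSq k)) *
        ‖mFourierCoeff (EuclideanSpace.complexify ∘ u t) k‖ ^ 2 ≤ Cg)
    {t : ℝ} (ht : t ∈ Ioo 0 T₀) :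
    ∃ (s e : ℝ) (ũ : ℝ → UnitAddTorus d → EuclideanSpace ℝ d) (q : ℝ → UnitAddTorus d → ℝ),
      0 < s ∧ s < t ∧ t < e ∧ e ≤ T₀ ∧ Torus.IsClassicalNSSolutionOn (Icc s e) ν (fun _ => F) ũ q ∧
        ∀ r ∈ Icc s e, ũ r = u r := by
  have hL : 0 < L := by linarith
  have hT₀L' : T₀ ≤ L := by linarith
  -- smooth slices
  have hUs : ∀ N, ∀ r ∈ Icc 0 T₀, Torus.IsSmooth (U N r) := fun N r hr =>
    (hU N).smooth_velocity.isSmooth_slice hr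
  have hūs : ∀ r ∈ Icc 0 L, Torus.IsSmooth (ū r) := fun r hr => hū.smooth_velocity.isSmooth_slice hr
  -- (a) the restart level on `[τ, T₀]`, `τ = t/2`
  set τ : ℝ := t / 2 with hτ_def
  have hτ0 : 0 < τ := by rw [hτ_def]; exact half_pos ht.1
  have hτt : τ < t := by rw [hτ_def]; linarith [ht.1]
  obtain ⟨σ, hσ, Cg, hCg⟩ := hGev τ hτ0
  obtain ⟨B, hB⟩ := Torus.exists_sobolevBounds_of_gevreyBound (d := d) hσ Cg
  obtain ⟨D, hD⟩ := hū.smooth_velocity.exists_integral_norm_laplacian_laplacian_sq_le hL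
  set M : ℝ := 2 * B + 2 * D with hM_def
  have hlevel : ∀ r ∈ Icc τ T₀, ∀ S : Finset (d → ℤ),
      ∑ k ∈ S, (1 + Torus.freqNormSq k) ^ 4 *
        ‖mFourierCoeff (EuclideanSpace.complexify ∘ fun y => u r y - ū r y) k‖ ^ 2 ≤ M := by
    intro r hr S
    have hr' : r ∈ Ioc 0 T₀ := ⟨hτ0.trans_le hr.1, hr.2⟩
    have hrL : r ∈ Icc 0 L := ⟨hr'.1.le, hr.2.trans hT₀L'⟩
    have h1 := (hB (u r) (hus r hr') (hCg r hr)).2.2.2.2.2 S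
    have h2 := (Torus.sum_one_add_freqNormSq_pow_four_mul_sq_norm_mFourierCoeff_le (hūs r hrL)
      (hūmean r hrL) S).trans (hD r hrL)
    have h3 := Torus.sum_mul_norm_sq_mFourierCoeff_sub_le (hus r hr').integrable (hūs r hrL).integrable
      (wt := fun k => (1 + Torus.freqNormSq k) ^ 4)
      (fun k => by have := Torus.freqNormSq_nonneg k; positivity) S
    rw [hM_def]
    linarith [mul_le_mul_of_nonneg_left h1 zero_le_two, mul_le_mul_of_nonneg_left h2 zero_le_two]
  -- (b) the uniform restart step, the lifespan at level `E₁'`, and the window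
  obtain ⟨θ, hθ, hθL, hE5⟩ := Torus.perturbedNS_exists_local_of_le hd.le hν hL hū.smooth_velocity
    hū.divFree M (half_pos hL)
  obtain ⟨T₂, hT₂, Y, hlife⟩ :=
    Torus.IsClassicalNSSolutionOn.enstrophy_lifespan (d := d) hd hν E₁' (Torus.gradNormSq F)
  set θ' : ℝ := min θ T₂ with hθ'_def
  have hθ'0 : 0 < θ' := lt_min hθ hT₂
  set s : ℝ := max τ (t - θ' / 2) with hs_def
  have hsτ : τ ≤ s := le_max_left _ _
  have hs0 : 0 < s := hτ0.trans_le hsτ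
  have hst : s < t := max_lt hτt (by linarith)
  have hsT₀ : s < T₀ := hst.trans ht.2
  set τ₃ : ℝ := min θ' (T₀ - s) with hτ₃_def
  have hτ₃0 : 0 < τ₃ := lt_min hθ'0 (by linarith)
  have hτ₃θ : τ₃ ≤ θ := (min_le_left _ _).trans (min_le_left _ _)
  have hτ₃T₂ : τ₃ ≤ T₂ := (min_le_left _ _).trans (min_le_right _ _)
  have heT₀ : s + τ₃ ≤ T₀ := by linarith [min_le_right θ' (T₀ - s)]
  have hte : t < s + τ₃ := by
    rw [hτ₃_def]
    rcases le_total θ' (T₀ - s) with h | h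
    · rw [min_eq_left h]
      have : t - θ' / 2 ≤ s := le_max_right _ _
      linarith
    · rw [min_eq_right h]
      linarith [ht.2]
  have hsI : s ∈ Ioc 0 T₀ := ⟨hs0, hsT₀.le⟩
  have hsL : s ∈ Icc 0 L := ⟨hs0.le, hsT₀.le.trans hT₀L'⟩
  have hsθL : s + θ ≤ L := by linarith
  have hsub₀ : Icc s (s + τ₃) ⊆ Icc 0 T₀ := Icc_subset_Icc hs0.le heT₀
  have hsub₁ : Icc s (s + τ₃) ⊆ Ioc 0 T₀ := fun r hr => ⟨hs0.trans_le hr.1, hr.2.trans heT₀⟩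
  have hsτ₃ : s < s + τ₃ := by linarith
  -- (c) restart at `s` from `u(s) - ū(s)`
  have huss : Torus.IsSmooth (u s) := hus s hsI
  have hūss : Torus.IsSmooth (ū s) := hūs s hsL
  have hv₀ : Torus.IsSmooth (fun y => u s y - ū s y) := huss.sub hūss
  have hv₀div : Torus.IsDivFree (fun y => u s y - ū s y) := fun x => by
    rw [show (fun y => u s y - ū s y) = u s - ū s from rfl,
      Torus.divergence_sub (huss.isContDiff (by simp)) (hūss.isContDiff (by simp)), hudiv s hsI x,
      hū.divFree s hsL x, sub_zero]
  have hv₀mean : Torus.HasZeroMean (fun y => u s y - ū s y) :=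
    (humean s hsI).sub (hūmean s hsL) huss.integrable hūss.integrable
  obtain ⟨v, q, hv, hq, hvdiv, hvmean, -, hveq, hvs⟩ :=
    hE5 s hsL hsθL _ hv₀ hv₀div hv₀mean (hlevel s ⟨hsτ, hsT₀.le⟩)
  have hsθ : s < s + θ := by linarith
  have h₂ := (hū.mono (Icc_subset_Icc hs0.le hsθL) (uniqueDiffOn_Icc hsθ)).add_perturbation hsθ hv hq
    hvdiv hveq
  have h₂' : Torus.IsClassicalNSSolutionOn (Icc s (s + τ₃)) ν (fun _ => F) (fun r x => ū r x + v r x)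
      (fun r x => pbar r x + q r x) :=
    h₂.mono (Icc_subset_Icc le_rfl (by linarith)) (uniqueDiffOn_Icc hsτ₃)
  have hpt : ∀ x, ū s x + v s x = u s x := fun x => by
    rw [hvs]
    simp
  have h₂s : (fun x => ū s x + v s x) = u s := funext hpt
  have h₂mean : ∀ r ∈ Icc s (s + τ₃), Torus.HasZeroMean ((fun r x => ū r x + v r x) r) := by
    intro r hr
    have hrL : r ∈ Icc 0 L := ⟨hs0.le.trans hr.1, by linarith [hr.2]⟩
    have hrθ : r ∈ Icc s (s + θ) := ⟨hr.1, by linarith [hr.2]⟩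
    exact (hūmean r hrL).add (hvmean r hrθ) (hūs r hrL).integrable (hv.isSmooth_slice hrθ).integrable
  -- (d) identification with the limit on the window, by `V`-stability at level `E₁'`
  obtain ⟨C₃, hC₃⟩ := Torus.IsClassicalNSSolutionOn.h1_sub_le_mul_of_integral_laplacian_sq_le (d := d)
    hd hν (2 * E₁' + 1) Y τ₃ hτ₃0
  have hgrad₀ : Torus.gradNormSq ((fun r x => ū r x + v r x) s) ≤ E₁' := by
    show Torus.gradNormSq (fun x => ū s x + v s x) ≤ E₁'
    rw [h₂s]
    exact huE s hsI
  have hgrad₂ : ∀ r ∈ Icc s (s + τ₃), Torus.gradNormSq ((fun r x => ū r x + v r x) r) ≤ 2 * E₁' + 1 :=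
    fun r hr => (hlife h₂' hsτ₃ hgrad₀ (fun _ _ => le_rfl)).1 r hr (by linarith [hr.2])
  have hgradU : ∀ N, ∀ r ∈ Icc s (s + τ₃), Torus.gradNormSq (U N r) ≤ 2 * E₁' + 1 := fun N r hr =>
    (hlife ((hU N).mono hsub₀ (uniqueDiffOn_Icc hsτ₃)) hsτ₃ (hUE N s ⟨hs0.le, hsT₀.le⟩)
      (fun _ _ => le_rfl)).1 r hr (by linarith [hr.2])
  have hYU : ∀ N, ∫ r in s..(s + τ₃), (∫ x, ‖Torus.laplacian (U N r) x‖ ^ 2) ≤ Y := fun N =>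
    (hlife ((hU N).mono hsub₀ (uniqueDiffOn_Icc hsτ₃)) hsτ₃ (hUE N s ⟨hs0.le, hsT₀.le⟩)
      (fun _ _ => le_rfl)).2 (s + τ₃) ⟨hsτ₃.le, le_rfl⟩ (by linarith)
  have hident : ∀ r ∈ Icc s (s + τ₃), (fun r x => ū r x + v r x) r = u r := by
    intro r hr
    have hrI : r ∈ Ioc 0 T₀ := hsub₁ hr
    have hr₀ : r ∈ Icc 0 T₀ := hsub₀ hr
    -- `V`-stability from time `s`
    have hstab : ∀ N, (∫ x, ‖ū r x + v r x - U N r x‖ ^ 2) +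
        Torus.gradNormSq (fun y => ū r y + v r y - U N r y) ≤
        C₃ * ((∫ x, ‖u s x - U N s x‖ ^ 2) + Torus.gradNormSq (fun y => u s y - U N s y)) := by
      intro N
      have h := hC₃ h₂' ((hU N).mono hsub₀ (uniqueDiffOn_Icc hsτ₃)) h₂mean
        (fun r hr => hUmean N r (hsub₀ hr)) hgrad₂ (hgradU N) (hYU N) r hr
      simp only [hpt] at h
      exact h
    -- the right-hand side tends to zero
    have hlim : Tendsto (fun N => C₃ * ((∫ x, ‖u s x - U N s x‖ ^ 2) +
        Torus.gradNormSq (fun y => u s y - U N s y))) atTop (𝓝 0) := by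
      have h := (hconv s hsI).const_mul C₃
      rw [mul_zero] at h
      refine h.congr fun N => ?_
      rw [Torus.h1DistSq_comm]
    have hL2 : Tendsto (fun N => ∫ x, ‖U N r x - (ū r x + v r x)‖ ^ 2) atTop (𝓝 0) := by
      refine tendsto_of_tendsto_of_tendsto_of_le_of_le tendsto_const_nhds hlim
        (fun N => integral_nonneg fun x => sq_nonneg _) fun N => ?_
      rw [Torus.integral_norm_sub_sq_comm]
      linarith [hstab N, Torus.gradNormSq_nonneg (fun y => ū r y + v r y - U N r y)]
    have hL2' : Tendsto (fun N => ∫ x, ‖U N r x - u r x‖ ^ 2) atTop (𝓝 0) :=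
      tendsto_of_tendsto_of_tendsto_of_le_of_le tendsto_const_nhds (hconv r hrI)
        (fun N => integral_nonneg fun x => sq_nonneg _)
        (fun N => le_add_of_nonneg_right (Torus.gradNormSq_nonneg _))
    exact Torus.eq_of_tendsto_integral_norm_sub_sq (v := fun N => U N r) (fun N => hUs N r hr₀)
      (h₂'.smooth_velocity.isSmooth_slice hr) (hus r hrI) hL2 hL2'
  exact ⟨s, s + τ₃, _, _, hs0, hst, hte, heT₀, h₂', hident⟩

/-- **Limits of classical Navier–Stokes solutions solve the equations on `(0, T₀)`.** In the
setting of the file header there is a pressure `p` such that `(u, p)` is a classical solution of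
NS_ν(F) on `(0, T₀) × T^d`: by `exists_window_of_limit_slices` every time has a neighbourhood on
which `u` is the velocity of a classical solution; the window pressures normalised at a base point
agree on overlaps (`pressure_sub_eq_of_eventuallyEq`), and classical solutions are local in time
(`Torus.IsClassicalNSSolutionOn.of_local`) — Robinson–Rodrigo–Sadowski 2016, Thm 7.5 with §8.1.
[cite: RobinsonRodrigoSadowskiCUP2016, Thm 7.5 with §8.1] -/
theorem _root_.Literature.Analysis.FunctionSpaces.Torus.IsClassicalNSSolutionOn.exists_pressure_of_limit_slices
    (hd : Fintype.card d = 3) (hν : 0 < ν)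
    (hū : Torus.IsClassicalNSSolutionOn (Icc 0 L) ν (fun _ => F) ū pbar)
    (hūmean : ∀ t ∈ Icc 0 L, Torus.HasZeroMean (ū t)) (hT₀ : 0 < T₀) (hT₀L : T₀ + L / 2 ≤ L)
    (hU : ∀ N, Torus.IsClassicalNSSolutionOn (Icc 0 T₀) ν (fun _ => F) (U N) (P N))
    (hUmean : ∀ N, ∀ t ∈ Icc 0 T₀, Torus.HasZeroMean (U N t))
    (hUE : ∀ N, ∀ t ∈ Icc 0 T₀, Torus.gradNormSq (U N t) ≤ E₁')
    (hus : ∀ t ∈ Ioc 0 T₀, Torus.IsSmooth (u t)) (hudiv : ∀ t ∈ Ioc 0 T₀, Torus.IsDivFree (u t))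
    (humean : ∀ t ∈ Ioc 0 T₀, Torus.HasZeroMean (u t))
    (huE : ∀ t ∈ Ioc 0 T₀, Torus.gradNormSq (u t) ≤ E₁')
    (hconv : ∀ t ∈ Ioc 0 T₀, Tendsto (fun N => (∫ x, ‖U N t x - u t x‖ ^ 2) +
      Torus.gradNormSq (fun x => U N t x - u t x)) atTop (𝓝 0))
    (hGev : ∀ τ : ℝ, 0 < τ → ∃ σ : ℝ, 0 < σ ∧ ∃ Cg : ℝ, ∀ t ∈ Icc τ T₀, ∀ S : Finset (d → ℤ),
      ∑ k ∈ S, Real.exp (2 * σ * Real.sqrt (Torus.freqNormSq k)) *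
        ‖mFourierCoeff (EuclideanSpace.complexify ∘ u t) k‖ ^ 2 ≤ Cg) :
    ∃ p : ℝ → UnitAddTorus d → ℝ, Torus.IsClassicalNSSolutionOn (Ioo 0 T₀) ν (fun _ => F) u p := by
  have hwin : ∀ t ∈ Ioo 0 T₀, ∃ (s e : ℝ) (ũ : ℝ → UnitAddTorus d → EuclideanSpace ℝ d)
      (q : ℝ → UnitAddTorus d → ℝ), 0 < s ∧ s < t ∧ t < e ∧ e ≤ T₀ ∧
      Torus.IsClassicalNSSolutionOn (Icc s e) ν (fun _ => F) ũ q ∧ ∀ r ∈ Icc s e, ũ r = u r :=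
    fun t ht => hū.exists_window_of_limit_slices hd hν hūmean hT₀ hT₀L hU hUmean hUE hus hudiv humean
      huE hconv hGev ht
  choose! sW eW uW qW hs0 hst hte heT hsol heq using hwin
  set x₀ : UnitAddTorus d := 0
  refine ⟨fun t x => qW t t x - qW t t x₀, Torus.IsClassicalNSSolutionOn.of_local isOpen_Ioo ?_⟩
  intro t ht
  refine ⟨Ioo (sW t) (eW t), isOpen_Ioo, ⟨hst t ht, hte t ht⟩,
    Ioo_subset_Ioo (hs0 t ht).le (heT t ht), uW t, fun r x => qW t r x - qW t r x₀,
    ((hsol t ht).mono Ioo_subset_Icc_self (uniqueDiffOn_Ioo _ _)).sub_pressure_apply x₀,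
    fun r hr => heq t ht r (Ioo_subset_Icc_self hr), fun r hr => ?_⟩
  -- the normalised pressures of two windows agree at a common interior time
  have hr' : r ∈ Ioo 0 T₀ := ⟨(hs0 t ht).trans hr.1, hr.2.trans_le (heT t ht)⟩
  have hev : ∀ᶠ ρ in 𝓝 r, uW t ρ = uW r ρ := by
    filter_upwards [Ioo_mem_nhds hr.1 hr.2, Ioo_mem_nhds (hst r hr') (hte r hr')] with ρ h1 h2
    rw [heq t ht ρ (Ioo_subset_Icc_self h1), heq r hr' ρ (Ioo_subset_Icc_self h2)]
  funext x
  exact (hsol t ht).pressure_sub_eq_of_eventuallyEq (hsol r hr') (Icc_mem_nhds hr.1 hr.2)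
    (Icc_mem_nhds (hst r hr') (hte r hr')) hev x x₀

end Windows

end Literature.Analysis.FluidPDE

end
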